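import Mathlib
import Literature.Analysis.FluidPDE.HelicalSectorSeminorm
import Literature.Analysis.FunctionSpaces.SobolevProductLawFourier
import HarnessLib

/-!
# RootDecompChiralityLadder / RootDecompChiralSerrin — crux X1 `OneSectorDissipationExtends` (stmt-NavierStokesRegularity-28741),
# stub `stub_full_le_sectors`

Registered stub (writer g10 first-prover skeleton, 2026-08-30), PROVED here verbatim: the critical seminorm of a field is
controlled by its two helical sectors, `‖v‖_{Ḣ^{1/2}} ≤ (2 (‖v₊‖²_{Ḣ^{1/2}} + ‖v₋‖²_{Ḣ^{1/2}}))^{1/2}`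
(Lerner–Vigneron 2022 §1.2: `v = v₊ + v₋` on the Fourier side, `Q₊ + Q₋ = 1`).

Proof: pointwise on the Fourier side `𝓕v(ξ) = Q₊(ξ)𝓕v(ξ) + Q₋(ξ)𝓕v(ξ)` (`HelicalSector.spinSymbol_add`), so
`‖𝓕v‖² ≤ 2(‖Q₊𝓕v‖² + ‖Q₋𝓕v‖²)`; integrate against `‖ξ‖` (the sector integrands are a.e.-measurable: the spin symbol is a
measurable function of `(ξ, F)`), take square roots. Off `L²` both sides are `⊤`. No PDE.
Decoration toward S; Navier–Stokes regularity is NOT proved by anything here (rung 0).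
-/

-- the summit and its single sub-problem share the name (CONVENTIONS §1), as in every Theorems file
set_option linter.dupNamespace false

noncomputable section

open MeasureTheory
open scoped ENNReal FourierTransform
open Literature.Analysis.FluidPDE Literature.Analysis.FluidPDE.HelicalSector
open Literature.Analysis.FunctionSpaces.EuclideanSpace (complexify)

namespace Summit.NavierStokesRegularity.NavierStokesRegularity.Theorems.OneSectorDissipationExtends

/-- The components of the symbol `i ξ × F` depend continuously on `(ξ, F)`. [folklore] -/
theorem continuous_icross :
    Continuous fun p : EuclideanSpace ℝ (Fin 3) × EuclideanSpace ℂ (Fin 3) => icross p.1 p.2 := by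
  unfold icross
  refine (PiLp.continuous_toLp 2 _).comp ?_
  refine continuous_pi fun i => ?_
  fin_cases i <;> simp <;> fun_prop

/-- The spin symbol `Q_σ(ξ) F` is a measurable function of `(ξ, F)`. [folklore] -/
theorem measurable_spinSymbol (σ : ℝ) :
    Measurable fun p : EuclideanSpace ℝ (Fin 3) × EuclideanSpace ℂ (Fin 3) => spinSymbol σ p.1 p.2 := by
  unfold spinSymbol
  have h1 : Measurable fun p : EuclideanSpace ℝ (Fin 3) × EuclideanSpace ℂ (Fin 3) =>
      (((σ / ‖p.1‖ : ℝ) : ℂ)) := by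
    refine Complex.measurable_ofReal.comp ?_
    exact measurable_const.div measurable_fst.norm
  exact ((measurable_snd.add (h1.smul continuous_icross.measurable)).const_smul ((2 : ℂ)⁻¹))

/-- Along an a.e.-measurable amplitude `F`, `ξ ↦ Q_σ(ξ) F(ξ)` is a.e.-measurable. [folklore] -/
theorem aemeasurable_spinSymbol (σ : ℝ) {F : EuclideanSpace ℝ (Fin 3) → EuclideanSpace ℂ (Fin 3)}
    (hF : AEMeasurable F volume) : AEMeasurable (fun ξ => spinSymbol σ ξ (F ξ)) volume := by
  have h2 : AEMeasurable (fun ξ : EuclideanSpace ℝ (Fin 3) => (ξ, F ξ)) volume := aemeasurable_id.prodMk hF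
  have h3 : AEMeasurable ((fun p : EuclideanSpace ℝ (Fin 3) × EuclideanSpace ℂ (Fin 3) => spinSymbol σ p.1 p.2) ∘
      (fun ξ : EuclideanSpace ℝ (Fin 3) => (ξ, F ξ))) volume := (measurable_spinSymbol σ).comp_aemeasurable h2
  exact h3

/-- **Registered stub `stub_full_le_sectors`** of crux `OneSectorDissipationExtends` (stmt-NavierStokesRegularity-28741),
verbatim: the two helical sectors control the critical seminorm. [cite: LernerVigneron2022, §1.2 (1.26)–(1.28), p. 8] -/
theorem stub_full_le_sectors : ∀ v : EuclideanSpace ℝ (Fin 3) → EuclideanSpace ℝ (Fin 3), Function.eHomSobolevSeminorm (1 / 2 : ℝ) (Literature.Analysis.FunctionSpaces.EuclideanSpace.complexify ∘ v) ≤ (2 * (Literature.Analysis.FluidPDE.HelicalSector.eSeminormSq 1 (1 / 2 : ℝ) v + Literature.Analysis.FluidPDE.HelicalSector.eSeminormSq (-1) (1 / 2 : ℝ) v)) ^ (1 / 2 : ℝ) := by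
  intro v
  by_cases h : MemLp (complexify ∘ v) 2 (volume : Measure (EuclideanSpace ℝ (Fin 3)))
  · have hF : fourierL2 v = (((𝓕 (h.toLp (complexify ∘ v)) : Lp (EuclideanSpace ℂ (Fin 3)) 2
        (volume : Measure (EuclideanSpace ℝ (Fin 3)))) : EuclideanSpace ℝ (Fin 3) → EuclideanSpace ℂ (Fin 3))) := by
      rw [fourierL2, dif_pos h]
    have hL : Function.eHomSobolevSeminorm (1 / 2 : ℝ) (complexify ∘ v) =
        (∫⁻ ξ, ‖ξ‖ₑ ^ (2 * (1 / 2 : ℝ)) * ‖fourierL2 v ξ‖ₑ ^ 2) ^ (1 / 2 : ℝ) := by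
      rw [Function.eHomSobolevSeminorm, dif_pos h, Literature.Analysis.FunctionSpaces.eHomSobolevSeminorm, hF]
    have hR : ∀ σ : ℝ, eSeminormSq σ (1 / 2 : ℝ) v =
        ∫⁻ ξ, ‖ξ‖ₑ ^ (2 * (1 / 2 : ℝ)) * ‖spinSymbol σ ξ (fourierL2 v ξ)‖ₑ ^ 2 := fun σ => by
      rw [eSeminormSq, if_pos h]
    rw [hL, hR, hR]
    refine ENNReal.rpow_le_rpow ?_ (by norm_num)
    have hFm : AEMeasurable (fourierL2 v) volume := by rw [hF]; exact (Lp.aestronglyMeasurable _).aemeasurable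
    set F := fourierL2 v with hFdef
    have hPm : AEMeasurable (fun ξ : EuclideanSpace ℝ (Fin 3) =>
        2 * (‖ξ‖ₑ ^ (2 * (1 / 2 : ℝ)) * ‖spinSymbol 1 ξ (F ξ)‖ₑ ^ 2)) volume :=
      ((measurable_id.enorm.pow_const _).aemeasurable.mul
        ((aemeasurable_spinSymbol 1 hFm).enorm.pow_const _)).const_mul _
    -- pointwise: `‖F‖² ≤ 2 (‖Q₊F‖² + ‖Q₋F‖²)`
    have hpt : ∀ ξ : EuclideanSpace ℝ (Fin 3), ‖ξ‖ₑ ^ (2 * (1 / 2 : ℝ)) * ‖F ξ‖ₑ ^ 2 ≤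
        2 * (‖ξ‖ₑ ^ (2 * (1 / 2 : ℝ)) * ‖spinSymbol 1 ξ (F ξ)‖ₑ ^ 2) +
          2 * (‖ξ‖ₑ ^ (2 * (1 / 2 : ℝ)) * ‖spinSymbol (-1) ξ (F ξ)‖ₑ ^ 2) := by
      intro ξ
      have hsum : F ξ = spinSymbol 1 ξ (F ξ) + spinSymbol (-1) ξ (F ξ) := (spinSymbol_add ξ (F ξ)).symm
      have h1 : ‖F ξ‖ₑ ≤ ‖spinSymbol 1 ξ (F ξ)‖ₑ + ‖spinSymbol (-1) ξ (F ξ)‖ₑ := by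
        conv_lhs => rw [hsum]
        exact enorm_add_le _ _
      calc ‖ξ‖ₑ ^ (2 * (1 / 2 : ℝ)) * ‖F ξ‖ₑ ^ 2
          ≤ ‖ξ‖ₑ ^ (2 * (1 / 2 : ℝ)) * (‖spinSymbol 1 ξ (F ξ)‖ₑ + ‖spinSymbol (-1) ξ (F ξ)‖ₑ) ^ 2 := by
            gcongr
        _ ≤ ‖ξ‖ₑ ^ (2 * (1 / 2 : ℝ)) * (2 * (‖spinSymbol 1 ξ (F ξ)‖ₑ ^ 2 + ‖spinSymbol (-1) ξ (F ξ)‖ₑ ^ 2)) := by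
            gcongr; exact Literature.Analysis.FunctionSpaces.FourierProductLaw.ennreal_add_sq_le_two_mul _ _
        _ = _ := by ring
    calc ∫⁻ ξ, ‖ξ‖ₑ ^ (2 * (1 / 2 : ℝ)) * ‖F ξ‖ₑ ^ 2
        ≤ ∫⁻ ξ, (2 * (‖ξ‖ₑ ^ (2 * (1 / 2 : ℝ)) * ‖spinSymbol 1 ξ (F ξ)‖ₑ ^ 2) +
            2 * (‖ξ‖ₑ ^ (2 * (1 / 2 : ℝ)) * ‖spinSymbol (-1) ξ (F ξ)‖ₑ ^ 2)) := lintegral_mono hpt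
      _ = 2 * (∫⁻ ξ, ‖ξ‖ₑ ^ (2 * (1 / 2 : ℝ)) * ‖spinSymbol 1 ξ (F ξ)‖ₑ ^ 2) +
            2 * (∫⁻ ξ, ‖ξ‖ₑ ^ (2 * (1 / 2 : ℝ)) * ‖spinSymbol (-1) ξ (F ξ)‖ₑ ^ 2) := by
          rw [lintegral_add_left' hPm, lintegral_const_mul' _ _ ENNReal.ofNat_ne_top,
            lintegral_const_mul' _ _ ENNReal.ofNat_ne_top]
      _ = 2 * ((∫⁻ ξ, ‖ξ‖ₑ ^ (2 * (1 / 2 : ℝ)) * ‖spinSymbol 1 ξ (F ξ)‖ₑ ^ 2) +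
            ∫⁻ ξ, ‖ξ‖ₑ ^ (2 * (1 / 2 : ℝ)) * ‖spinSymbol (-1) ξ (F ξ)‖ₑ ^ 2) := by ring
  · -- off `L²`: both sides are `⊤`
    have hR : ∀ σ : ℝ, eSeminormSq σ (1 / 2 : ℝ) v = ⊤ := fun σ => by rw [eSeminormSq, if_neg h]
    rw [hR, hR, top_add, ENNReal.mul_top (by norm_num), ENNReal.top_rpow_of_pos (by norm_num)]
    exact le_top

end Summit.NavierStokesRegularity.NavierStokesRegularity.Theorems.OneSectorDissipationExtends

end
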